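import Mathlib.GroupTheory.Transfer
import Literature.NumberTheory.ComplexMultiplication.CMTypeRank
import HarnessLib

/-!
# Tate's half transfer `F_Φ` of a CM type — the group theory
# (Milne, *The fundamental theorem of complex multiplication*, arXiv:0705.3446, §4.2; Tate 1981)

Topic `NumberTheory/ComplexMultiplication`; namespace `Literature.NumberTheory.ComplexMultiplication`.  Lane
`lit-hodgefound` (Track 2, Layer A3 skeleton seat `skel-3`, row A3-G45 FILE 1 of 4: the GROUP THEORY of Tate's half
transfer; FILE 2 `…/NumberFields/IdelicArtinMapConjugation` is the conjugation functoriality of the Artin map, FILE 3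
`…/ComplexMultiplication/TateHalfTransferCM` instantiates this file at `G = Γ_ℚ`, `H = Γ_E`, `ι =` complex conjugation,
FILE 4 `…/ComplexMultiplication/TaniyamaElement` is Milne's Prop. 4.6, the Taniyama element `f_Φ`).  Definitions with
bodies (`HalfTransfer.IsSymmSection`, `halfTransferFactor`, `halfTransferWith`, `halfTransfer`) and theorems, all proved;
no named fact, no instance (D-0026, net debt 0).

## The print, verbatim

J. S. Milne, *The fundamental theorem of complex multiplication*, arXiv:0705.3446 [Milne2007FundamentalCM], §4.2
«Definition of `f_Φ(σ)`» (held `paper:arxiv-0705.3446` p0019 L85–L152), following J. Tate, *On conjugation of abelian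
varieties of CM type* (handwritten manuscript, 1981):

> «Choose an embedding `E ↪ ℂ`, and extend it to an embedding `i : E^ab ↪ ℂ`. Choose elements `w_ρ ∈ Aut(ℂ)`, one for
> each `ρ ∈ Hom(E, ℂ)`, such that `w_ρ ∘ i|E = ρ`, `w_{ιρ} = ι w_ρ`. […] Thus `i⁻¹ ∘ w_{σρ}⁻¹ σ w_ρ ∘ i ∈ Gal(E^ab/E)`,
> and we can define `F_Φ : Aut(ℂ) → Gal(E^ab/E)` by `F_Φ(σ) = ∏_{φ∈Φ} i⁻¹ ∘ w_{σφ}⁻¹ σ w_φ ∘ i`.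
> LEMMA 4.4. The element `F_Φ` is independent of the choice of `{w_ρ}`.  PROOF. Any other choice is of the form
> `w'_ρ = w_ρ h_ρ`, `h_ρ ∈ Aut(ℂ/iE)`. Thus `F_Φ(σ)` is changed by `i⁻¹ ∘ (∏_{φ∈Φ} h_{σφ}⁻¹ h_φ) ∘ i`. The conditions on
> `w` and `w'` imply that `h_{ιρ} = h_ρ`, and it follows that the inside product is `1` because `σ` permutes the unordered
> pairs `{φ, ιφ}` and so `∏_{φ∈Φ} h_φ = ∏_{φ∈Φ} h_{σφ}`. […] Thus we can suppose `E ⊂ ℂ` and ignore `i`; then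
> `F_Φ(σ) = ∏_{φ∈Φ} w_{σφ}⁻¹ σ w_φ mod Aut(ℂ/E^ab)` where the `w_ρ` are elements of `Aut(ℂ)` such that `w_ρ|E = ρ`,
> `w_{ιρ} = ι w_ρ`.»

and, in the proofs of Prop. 4.6 and Prop. 4.8 (p0019 L160–p0020 L31): «`art_E(f)·ι art_E(f) ι⁻¹ = F_Φ(σ)·F_{ιΦ}(σ) =
Ver_{E/ℚ}(σ)`», «`F_{τΦ}(σ)·F_Φ(τ) = ∏_{φ∈Φ} w_{στφ}⁻¹·σ w_{τφ}·w_{τφ}⁻¹·τ w_φ = F_Φ(στ)`», «(c) `f_Φ(ι) = 1`».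

The `Γ_ℚ`-formulation: C. Blake, *A plectic Taniyama group*, arXiv:1606.03320 [Blake2016PlecticTaniyama] §1 «The
classical theory» (held `paper:arxiv-1606.03320` p0003 L31–L33): «Tate wrote down half-transfer map `F_Φ : Γ_ℚ → Γ_K^ab`
[…] This is defined by first taking a set of coset representatives `w_ρ` for `Γ_K ⊂ Γ_ℚ` such that `w_{cρ} = c w_ρ` for
all `ρ ∈ Σ_K` and mapping `g ∈ Γ_ℚ` to the element `F_Φ(g) = ∏_{ρ∈Φ} w_{gρ}⁻¹ g w_ρ mod Γ_{K^ab}` of `Γ_K^ab`, which is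
independent of the choice of coset representatives.»

## What is formalised (the group theory only)

A group `G` acting on a set `X` (in print `G = Aut(ℂ)` or `Γ_ℚ`, `X = Hom(E, ℂ)` or `Σ_E = Hom(E, Q̄)`), a base point
`x₀ ∈ X` (the chosen embedding `i|E`) whose stabiliser is a subgroup `H ≤ G` given EXTENSIONALLY by
`hH : ∀ g, g ∈ H ↔ g • x₀ = x₀` (in print `H = Aut(ℂ/E) ≅ Γ_E`), a homomorphism `ϕ : H →* A` to a commutative group
(in print `H → Gal(E^ab/E)`), and an element `ι ∈ G` (complex conjugation).  A CM type is a subset `Φ ⊆ X` with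
`IsCMTypeWith ι Φ` (`…/CMTypeRank`: `x ∈ Φ ↔ ι • x ∉ Φ`, `ι` central and involutive ON `X`).

* §1 `HalfTransfer.IsSymmSection ι x₀ w` — Tate's systems of representatives: `w : X → G` with `w x • x₀ = x` and
  `w (ι • x) = ι · w x`; they exist as soon as `G` is transitive on `X`, `ι² = 1` and a CM type exists
  (`HalfTransfer.exists_isSymmSection`).
* §2 `halfTransferFactor hH hw σ x = w(σx)⁻¹ σ w(x) ∈ H` and **`halfTransferWith ϕ hH hw Φ σ = ∏_{x∈Φ} ϕ(w(σx)⁻¹ σ w(x))`**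
  for a given section `w`; the cocycle identity **`F_Φ(στ) = F_{τΦ}(σ)·F_Φ(τ)`** (`halfTransferWith_mul`, Milne's displayed
  computation in the proof of 4.8 (a)), `F_Φ(1) = 1`, **`F_Φ(ι) = 1`** for a symmetric section (4.8 (c) at the level of
  `F`), `F_Φ` is multiplicative on the stabiliser of `Φ`, transport along `ψ : A →* B`.
* §3 **LEMMA 4.4** `halfTransferWith_eq_of_isSymmSection`: for a CM type `Φ` the value does not depend on the symmetric
  section (the printed proof: `h_{ιρ} = h_ρ` and `∏_{φ∈Φ} h_φ = ∏_{φ∈σΦ} h_φ` because both `Φ` and `σΦ` are systems of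
  representatives of the pairs `{φ, ιφ}` — `finprod_mem_eq_of_isCMTypeWith`).
* §4 **`F_Φ(σ)·F_{Φᶜ}(σ) = Ver(σ)`**: the product over `Φ` and over its complement `Φᶜ = ιΦ` is the full transfer — for
  `X = G ⧸ H` literally Mathlib's `MonoidHom.transfer ϕ` (`halfTransferWith_mul_halfTransferWith_compl_eq_transfer`); and
  **`F_{ιΦ}^ϕ = F_Φ^{ϕ ∘ Inn(ι)}`** (`halfTransferWith_smul_eq`, `ι² = 1`): computing `F_{ιΦ}` with the symmetric section
  `ι w ι⁻¹` conjugates every factor by `ι` — the identity «`ι art_E(f) ι⁻¹ = F_{ιΦ}(σ)`» behind Prop. 4.6.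
* §5 the section-free **`halfTransfer ϕ x₀ hH ι Φ : G → A`** (value at any symmetric section, `1` if there is none) with
  the same identities.

NOT HERE: the number theory (FILES 2–4); Lemma 4.5 (independence of `i`: here `x₀` is fixed once and for all, as Blake
does with `K ⊂ Q̄`); Prop. 4.8 (b) for a general `τ` with `τE = E`; Prop. 4.9.

## References

* J. S. Milne, *The fundamental theorem of complex multiplication*, arXiv:0705.3446 (2007), §4.2 (Lemma 4.4, Lemma 4.5,
  Prop. 4.6, Prop. 4.8). [Milne2007FundamentalCM]
* C. Blake, *A plectic Taniyama group*, arXiv:1606.03320 (2016), §1. [Blake2016PlecticTaniyama]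
* J. Neukirch, *Algebraic Number Theory*, Springer 1999, Ch. IV §5 p. 271 (the transfer). [NeukirchANT1999]

## Provenance

Lane `lit-hodgefound`, seat `literature-prover-lit-hodgefound-skel-3-g29-0` (row A3-G45, FILE 1 of 4).
-/

noncomputable section

open scoped Pointwise

namespace Literature.NumberTheory.ComplexMultiplication

variable {G : Type*} [Group G] {X : Type*} [MulAction G X] {A : Type*} [CommGroup A]

/-! ### §0. CM types under translation -/

namespace IsCMTypeWith

variable {ι : G} {Φ : Set X} (h : IsCMTypeWith ι Φ)
include h

/-- `ι⁻¹` acts on `X` as `ι` does (`ι` is an involution on `X`). [cite: Milne2007FundamentalCM, §4.2 (w_{ιρ} = ι w_ρ)] -/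
theorem inv_smul_eq (x : X) : ι⁻¹ • x = ι • x :=
  inv_smul_eq_iff.2 (h.invol x).symm

/-- `ι⁻¹` commutes with every `g ∈ G` on `X`. [cite: Milne2007FundamentalCM, §4.2] -/
theorem smul_inv_smul_comm (g : G) (x : X) : g • ι⁻¹ • x = ι⁻¹ • g • x := by
  rw [h.inv_smul_eq, h.inv_smul_eq, h.comm]

/-- **A translate `g • Φ` of a CM type is a CM type** («`σ` permutes the unordered pairs `{φ, ιφ}`»).  A private
copy of `IsCMTypeWith.smul_set` of `…/ReflexDegreeQuadraticSubfieldBound` (kept private to keep this file's imports at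
`CMTypeRank`). [cite: Milne2007FundamentalCM, §4.2 Lemma 4.4 (proof)] -/
private theorem smul_set' (g : G) : IsCMTypeWith ι (g • Φ) where
  mem_iff x := by
    rw [Set.mem_smul_set_iff_inv_smul_mem, Set.mem_smul_set_iff_inv_smul_mem, h.mem_iff, h.comm]
  comm := h.comm
  invol := h.invol

/-- **The complement of a CM type is its conjugate: `Φᶜ = ι • Φ`** (cf. `IsCMTypeWith.rho_smul_set_eq_compl` of
`…/ReflexDegreeQuadraticSubfieldBound`, the same identity read right to left).
[cite: Milne2007FundamentalCM, §4.1 («Hom(E,ℂ) = Φ ∪ ιΦ (disjoint union)»)] -/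
theorem compl_eq_smul_set : Φᶜ = ι • Φ := by
  ext x
  rw [Set.mem_compl_iff, Set.mem_smul_set_iff_inv_smul_mem, h.inv_smul_eq, h.rho_smul_mem_iff]

/-- The complement of a CM type is a CM type.  A private copy of `IsCMTypeWith.compl` of
`…/SerreGroupCMTypeGenerators` (imports kept light). [cite: Milne2007FundamentalCM, §4.1] -/
private theorem compl' : IsCMTypeWith ι Φᶜ := by
  rw [h.compl_eq_smul_set]; exact h.smul_set' ι

/-- **Both `Φ` and `Ψ` are systems of representatives of the pairs `{x, ιx}`**: for an `ι`-invariant `f`,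
`∏_{x∈Φ} f x = ∏_{x∈Ψ} f x` for any two CM types (the step «`∏_{φ∈Φ} h_φ = ∏_{φ∈Φ} h_{σφ}`» of Lemma 4.4, via the
bijection `Φ → Ψ`, `x ↦ x` if `x ∈ Ψ`, `x ↦ ιx` otherwise). [cite: Milne2007FundamentalCM, §4.2 Lemma 4.4 (proof)] -/
theorem finprod_mem_eq_of_isCMTypeWith {M : Type*} [CommMonoid M] {Ψ : Set X} (hΨ : IsCMTypeWith ι Ψ)
    {f : X → M} (hf : ∀ x, f (ι • x) = f x) : ∏ᶠ x ∈ Φ, f x = ∏ᶠ x ∈ Ψ, f x := by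
  classical
  let e : X → X := fun x => if x ∈ Ψ then x else ι • x
  refine finprod_mem_eq_of_bijOn e ⟨fun x _ => ?_, fun x hx y hy hxy => ?_, fun z hz => ?_⟩ fun x _ => ?_
  · by_cases hx : x ∈ Ψ
    · simp only [e, if_pos hx]; exact hx
    · simp only [e, if_neg hx]; exact (hΨ.rho_smul_mem_iff x).2 hx
  · by_cases hxΨ : x ∈ Ψ <;> by_cases hyΨ : y ∈ Ψ
    · simpa only [e, if_pos hxΨ, if_pos hyΨ] using hxy
    · simp only [e, if_pos hxΨ, if_neg hyΨ] at hxy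
      rw [hxy] at hx
      exact ((h.mem_iff y).1 hy hx).elim
    · simp only [e, if_neg hxΨ, if_pos hyΨ] at hxy
      rw [← hxy] at hy
      exact ((h.mem_iff x).1 hx hy).elim
    · simp only [e, if_neg hxΨ, if_neg hyΨ] at hxy
      simpa only [h.invol] using congrArg (ι • ·) hxy
  · by_cases hzΦ : z ∈ Φ
    · exact ⟨z, hzΦ, by simp only [e, if_pos hz]⟩
    · refine ⟨ι • z, (h.rho_smul_mem_iff z).2 hzΦ, ?_⟩
      simp only [e, if_neg ((hΨ.mem_iff z).1 hz), hΨ.invol]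
  · by_cases hx : x ∈ Ψ
    · simp only [e, if_pos hx]
    · simp only [e, if_neg hx, hf]

end IsCMTypeWith

/-! ### §1. Symmetric systems of representatives -/

namespace HalfTransfer

/-- **A symmetric system of representatives** (Tate's `{w_ρ}`): `w : X → G` with `w x · x₀ = x` («`w_ρ ∘ i|E = ρ`»)
and `w (ι x) = ι · w x` («`w_{ιρ} = ι w_ρ`»).
[cite: Milne2007FundamentalCM, §4.2 (definition of F_Φ)] [cite: Blake2016PlecticTaniyama, §1 («w_{cρ} = c w_ρ»)] -/
structure IsSymmSection (ι : G) (x₀ : X) (w : X → G) : Prop where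
  /-- `w x` maps the base point to `x`. -/
  smul_base : ∀ x, w x • x₀ = x
  /-- `w (ι x) = ι · w x`. -/
  apply_smul : ∀ x, w (ι • x) = ι * w x

/-- **Symmetric systems of representatives exist** when `G` is transitive on `X`, `ι² = 1` in `G` and a CM type `Φ`
exists: «choose `w_ρ` for `ρ ∈ Φ` […] to satisfy the first equation, and then define `w_ρ` for the remaining `ρ` by the
second equation». [cite: Milne2007FundamentalCM, §4.2 (definition of F_Φ)] -/
theorem exists_isSymmSection [MulAction.IsPretransitive G X] {ι : G} (hι : ι * ι = 1) (x₀ : X) {Φ : Set X}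
    (hΦ : IsCMTypeWith ι Φ) : ∃ w : X → G, IsSymmSection ι x₀ w := by
  classical
  choose g hg using fun x : X => MulAction.exists_smul_eq G x₀ x
  refine ⟨fun x => if x ∈ Φ then g x else ι * g (ι • x), ⟨fun x => ?_, fun x => ?_⟩⟩
  · by_cases hx : x ∈ Φ
    · simp only [if_pos hx, hg]
    · simp only [if_neg hx, mul_smul, hg, hΦ.invol]
  · by_cases hx : x ∈ Φ
    · simp only [if_neg ((hΦ.mem_iff x).1 hx), if_pos hx, hΦ.invol]
    · simp only [if_pos ((hΦ.rho_smul_mem_iff x).2 hx), if_neg hx, ← mul_assoc, hι, one_mul]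

variable {ι : G} {x₀ : X} {w : X → G}

/-- For a symmetric section and `ι` central on `X`, `ι · w x · ι⁻¹` is again a symmetric section (the section used to
compute `F_{ιΦ}`). [cite: Milne2007FundamentalCM, §4.2 Prop. 4.6 (proof)] -/
theorem IsSymmSection.conj (hw : IsSymmSection ι x₀ w) {Φ : Set X} (hΦ : IsCMTypeWith ι Φ) :
    IsSymmSection ι x₀ fun x => ι * w x * ι⁻¹ where
  smul_base x := by
    rw [mul_smul, mul_smul, hΦ.smul_inv_smul_comm (w x) x₀, hw.smul_base, smul_inv_smul]
  apply_smul x := by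
    simp only [hw.apply_smul, mul_assoc]

end HalfTransfer

open HalfTransfer

/-! ### §2. The half transfer computed with a given section -/

section With

variable {H : Subgroup G} {x₀ : X} (ϕ : H →* A) (hH : ∀ g : G, g ∈ H ↔ g • x₀ = x₀)
  {w : X → G} (hw : ∀ x, w x • x₀ = x)

/-- **The factor `w(σx)⁻¹ · σ · w(x) ∈ H`** of Tate's product («`w_{σρ}⁻¹ σ w_ρ ∘ i|E = i`, thus […] `∈ Gal(E^ab/E)`»):
it fixes the base point. [cite: Milne2007FundamentalCM, §4.2 (definition of F_Φ)] -/
def halfTransferFactor (σ : G) (x : X) : H :=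
  ⟨(w (σ • x))⁻¹ * σ * w x, (hH _).2 (by rw [mul_smul, mul_smul, hw, inv_smul_eq_iff, hw])⟩

/-- Unfolding. [cite: Milne2007FundamentalCM, §4.2 (definition of F_Φ)] -/
@[simp] theorem coe_halfTransferFactor (σ : G) (x : X) :
    (halfTransferFactor hH hw σ x : G) = (w (σ • x))⁻¹ * σ * w x := rfl

/-- **`F_Φ^w(σ) = ∏_{x ∈ Φ} ϕ(w(σx)⁻¹ σ w(x))`** — Tate's half transfer computed with the section `w` (a finite product
in the commutative group `A`; `finprod`, so `= 1` if `Φ` is infinite).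
[cite: Milne2007FundamentalCM, §4.2 (definition of F_Φ)] [cite: Blake2016PlecticTaniyama, §1] -/
def halfTransferWith (Φ : Set X) (σ : G) : A :=
  ∏ᶠ x ∈ Φ, ϕ (halfTransferFactor hH hw σ x)

/-- Unfolding. [cite: Milne2007FundamentalCM, §4.2 (definition of F_Φ)] -/
theorem halfTransferWith_def (Φ : Set X) (σ : G) :
    halfTransferWith ϕ hH hw Φ σ = ∏ᶠ x ∈ Φ, ϕ (halfTransferFactor hH hw σ x) := rfl

/-- `F_Φ^w(1) = 1`. [cite: Milne2007FundamentalCM, §4.2 Prop. 4.8] -/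
theorem halfTransferWith_one (Φ : Set X) : halfTransferWith ϕ hH hw Φ 1 = 1 := by
  refine finprod_mem_of_eqOn_one fun x _ => ?_
  have : halfTransferFactor hH hw 1 x = 1 := Subtype.ext (by simp)
  rw [this, map_one]; rfl

/-- The factor of `στ` at `x` is the factor of `σ` at `τx` times the factor of `τ` at `x`
(«`w_{στφ}⁻¹·σ w_{τφ}·w_{τφ}⁻¹·τ w_φ`»). [cite: Milne2007FundamentalCM, §4.2 Prop. 4.8 (proof of (a))] -/
theorem halfTransferFactor_mul (σ τ : G) (x : X) :
    halfTransferFactor hH hw (σ * τ) x = halfTransferFactor hH hw σ (τ • x) * halfTransferFactor hH hw τ x :=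
  Subtype.ext (by simp only [coe_halfTransferFactor, Subgroup.coe_mul, mul_smul]; group)

/-- **The cocycle identity `F_Φ(στ) = F_{τΦ}(σ) · F_Φ(τ)`** (for `Φ` finite; any section `w`) — Milne's computation
«`F_{τΦ}(σ)·F_Φ(τ) = ∏_{φ∈Φ} w_{στφ}⁻¹·σw_{τφ}·w_{τφ}⁻¹·τ w_φ = F_Φ(στ)`».
[cite: Milne2007FundamentalCM, §4.2 Prop. 4.8 (a) (proof)] -/
theorem halfTransferWith_mul {Φ : Set X} (hΦ : Φ.Finite) (σ τ : G) :
    halfTransferWith ϕ hH hw Φ (σ * τ) = halfTransferWith ϕ hH hw (τ • Φ) σ * halfTransferWith ϕ hH hw Φ τ := by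
  simp only [halfTransferWith_def]
  rw [← Set.image_smul, finprod_mem_image (MulAction.injective τ).injOn, ← finprod_mem_mul_distrib hΦ]
  exact finprod_mem_congr rfl fun x _ => by rw [halfTransferFactor_mul, map_mul]

/-- **`F_Φ` is multiplicative on the stabiliser of `Φ`**: `F_Φ(στ) = F_Φ(σ)·F_Φ(τ)` when `τΦ = Φ` (so `F_Φ` is a
homomorphism on `{τ | τΦ = Φ} = Aut(ℂ/E*)`). [cite: Milne2007FundamentalCM, §4.2 Prop. 4.8 (a), Prop. 4.9 (proof)] -/
theorem halfTransferWith_mul_of_smul_eq {Φ : Set X} (hΦ : Φ.Finite) (σ : G) {τ : G} (hτ : τ • Φ = Φ) :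
    halfTransferWith ϕ hH hw Φ (σ * τ) = halfTransferWith ϕ hH hw Φ σ * halfTransferWith ϕ hH hw Φ τ := by
  rw [halfTransferWith_mul ϕ hH hw hΦ, hτ]

/-- **`F_Φ^w(ι) = 1` for a symmetric section**: each factor is `w(ιx)⁻¹ ι w(x) = (ι w(x))⁻¹ ι w(x) = 1` — the level-`F`
form of «(c) `f_Φ(ι) = 1`». [cite: Milne2007FundamentalCM, §4.2 Prop. 4.8 (c)] -/
theorem halfTransferWith_eq_one_of_isSymmSection {ι : G} (hw' : IsSymmSection ι x₀ w) (Φ : Set X) :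
    halfTransferWith ϕ hH hw'.smul_base Φ ι = 1 := by
  refine finprod_mem_of_eqOn_one fun x _ => ?_
  have : halfTransferFactor hH hw'.smul_base ι x = 1 :=
    Subtype.ext (by simp only [coe_halfTransferFactor, hw'.apply_smul, mul_inv_rev, Subgroup.coe_one]; group)
  rw [this, map_one]; rfl

/-- Transport along `ψ : A →* B`: `ψ(F_Φ^{ϕ}) = F_Φ^{ψ ∘ ϕ}` (`Φ` finite). [cite: Milne2007FundamentalCM, §4.2 Lemma 4.5] -/
theorem map_halfTransferWith {B : Type*} [CommGroup B] (ψ : A →* B) {Φ : Set X} (hΦ : Φ.Finite) (σ : G) :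
    ψ (halfTransferWith ϕ hH hw Φ σ) = halfTransferWith (ψ.comp ϕ) hH hw Φ σ := by
  rw [halfTransferWith_def, ψ.map_finprod_mem _ hΦ]; rfl

/-- **`F_Φ^w(σ)·F_{Φᶜ}^w(σ) = ∏_{x∈X} ϕ(w(σx)⁻¹ σ w(x))`** — the product over a CM type and over its complement is the
full transfer product («`F_Φ(σ)·F_{ιΦ}(σ) = Ver_{E/ℚ}(σ)`», first half; `X` finite).
[cite: Milne2007FundamentalCM, §4.2 Prop. 4.6 (proof)] -/
theorem halfTransferWith_mul_halfTransferWith_compl [Finite X] (Φ : Set X) (σ : G) :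
    halfTransferWith ϕ hH hw Φ σ * halfTransferWith ϕ hH hw Φᶜ σ = ∏ᶠ x, ϕ (halfTransferFactor hH hw σ x) := by
  rw [halfTransferWith_def, halfTransferWith_def, ← finprod_mem_union disjoint_compl_right (Set.toFinite _)
    (Set.toFinite _), Set.union_compl_self, finprod_mem_univ]

end With

/-! ### §3. Lemma 4.4: independence of the symmetric section -/

section Independence

variable {H : Subgroup G} {x₀ : X} (ϕ : H →* A) (hH : ∀ g : G, g ∈ H ↔ g • x₀ = x₀) {ι : G}

/-- The quotient `h(x) = w(x)⁻¹ w'(x) ∈ H` of two sections («`w'_ρ = w_ρ h_ρ`, `h_ρ ∈ Aut(ℂ/iE)`»).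
[cite: Milne2007FundamentalCM, §4.2 Lemma 4.4 (proof)] -/
private def sectionQuot {w w' : X → G} (hw : ∀ x, w x • x₀ = x) (hw' : ∀ x, w' x • x₀ = x) (x : X) : H :=
  ⟨(w x)⁻¹ * w' x, (hH _).2 (by rw [mul_smul, hw', inv_smul_eq_iff, hw])⟩

/-- `factor'(σ, x) = h(σx)⁻¹ · factor(σ, x) · h(x)` («`F_Φ(σ)` is changed by `∏ h_{σφ}⁻¹ h_φ`»).
[cite: Milne2007FundamentalCM, §4.2 Lemma 4.4 (proof)] -/
private theorem halfTransferFactor_eq_sectionQuot {w w' : X → G} (hw : ∀ x, w x • x₀ = x) (hw' : ∀ x, w' x • x₀ = x)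
    (σ : G) (x : X) :
    halfTransferFactor hH hw' σ x =
      (sectionQuot hH hw hw' (σ • x))⁻¹ * halfTransferFactor hH hw σ x * sectionQuot hH hw hw' x :=
  Subtype.ext (by
    simp only [coe_halfTransferFactor, sectionQuot, Subgroup.coe_mul, Subgroup.coe_inv, mul_inv_rev, inv_inv]
    group)

/-- For symmetric sections the quotient is `ι`-invariant: «the conditions on `w` and `w'` imply that `h_{ιρ} = h_ρ`».
[cite: Milne2007FundamentalCM, §4.2 Lemma 4.4 (proof)] -/
private theorem sectionQuot_smul {w w' : X → G} (hw : IsSymmSection ι x₀ w) (hw' : IsSymmSection ι x₀ w') (x : X) :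
    sectionQuot hH hw.smul_base hw'.smul_base (ι • x) = sectionQuot hH hw.smul_base hw'.smul_base x :=
  Subtype.ext (by simp only [sectionQuot, hw.apply_smul, hw'.apply_smul, mul_inv_rev]; group)

/-- **LEMMA 4.4 (Tate): `F_Φ` is independent of the choice of the symmetric system `{w_ρ}`.**  For a CM type `Φ`
(w.r.t. `ι`) and two symmetric sections `w, w'`, the products `∏_{x∈Φ} ϕ(w(σx)⁻¹σw(x))` agree: the change is
`∏_{x∈Φ} ϕ(h(x)) / ∏_{x∈σΦ} ϕ(h(x))` with `h` `ι`-invariant, and `Φ`, `σΦ` are both transversals of the pairs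
`{x, ιx}`. [cite: Milne2007FundamentalCM, §4.2 Lemma 4.4] [cite: Blake2016PlecticTaniyama, §1 («independent of the choice of coset representatives»)] -/
theorem halfTransferWith_eq_of_isSymmSection [Finite X] {Φ : Set X} (hΦ : IsCMTypeWith ι Φ) {w w' : X → G}
    (hw : IsSymmSection ι x₀ w) (hw' : IsSymmSection ι x₀ w') (σ : G) :
    halfTransferWith ϕ hH hw.smul_base Φ σ = halfTransferWith ϕ hH hw'.smul_base Φ σ := by
  have hfin : Φ.Finite := Set.toFinite _
  let q : X → A := fun x => ϕ (sectionQuot hH hw.smul_base hw'.smul_base x)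
  have hq : ∀ x, q (ι • x) = q x := fun x => by
    simp only [q, sectionQuot_smul hH hw hw']
  -- `F' = F · (∏_{x∈Φ} q x) / (∏_{x∈Φ} q (σ x))`
  have h1 : halfTransferWith ϕ hH hw'.smul_base Φ σ =
      halfTransferWith ϕ hH hw.smul_base Φ σ * ((∏ᶠ x ∈ Φ, q x) / ∏ᶠ x ∈ Φ, q (σ • x)) := by
    rw [halfTransferWith_def, halfTransferWith_def, div_eq_mul_inv, ← finprod_mem_inv_distrib _ hfin,
      ← finprod_mem_mul_distrib hfin, ← finprod_mem_mul_distrib hfin]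
    refine finprod_mem_congr rfl fun x _ => ?_
    rw [halfTransferFactor_eq_sectionQuot hH hw.smul_base hw'.smul_base σ x, map_mul, map_mul, map_inv]
    simp only [q]
    rw [mul_comm (ϕ _)⁻¹, mul_assoc, mul_comm (ϕ _)⁻¹]
  -- `∏_{x∈Φ} q (σ x) = ∏_{x ∈ σΦ} q x = ∏_{x∈Φ} q x`
  have h2 : ∏ᶠ x ∈ Φ, q (σ • x) = ∏ᶠ x ∈ Φ, q x := by
    rw [← finprod_mem_image (MulAction.injective σ).injOn, Set.image_smul]
    exact (hΦ.smul_set' σ).finprod_mem_eq_of_isCMTypeWith hΦ hq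
  rw [h1, h2, div_self', mul_one]

end Independence

/-! ### §4. `F_Φ · F_{Φᶜ}` is the transfer; `F_{ιΦ}` is `F_Φ` conjugated by `ι` -/

section Transfer

variable {H : Subgroup G} (ϕ : H →* A)

/-- The stabiliser of the base point `1·H ∈ G ⧸ H` is `H`. [cite: NeukirchANT1999, Ch. IV §5 p. 271 (definition of Ver)] -/
theorem mem_iff_smul_quotient_one_eq (g : G) :
    g ∈ H ↔ g • ((1 : G) : G ⧸ H) = ((1 : G) : G ⧸ H) := by
  rw [MulAction.Quotient.smul_mk, smul_eq_mul, mul_one, eq_comm, QuotientGroup.eq, inv_one, one_mul]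

/-- **The full product is the transfer**: for `X = G ⧸ H` with base point `1·H` and any section `w`,
`∏_{q ∈ G⧸H} ϕ(w(σq)⁻¹ σ w(q)) = Ver(σ)` (Mathlib's `MonoidHom.transfer ϕ`, i.e. Neukirch's
«`Ver(σ mod G') = ∏_{ρ∈R} σ_ρ mod H'`» with `σρ = ρ'σ_ρ`, `ρ = w(q)`, `ρ' = w(σq)`).
[cite: NeukirchANT1999, Ch. IV §5 p. 271 (definition of Ver)] [cite: Milne2007FundamentalCM, §4.2 Prop. 4.6 (proof)] -/
theorem finprod_halfTransferFactor_eq_transfer [H.FiniteIndex] {w : G ⧸ H → G}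
    (hw : ∀ q : G ⧸ H, w q • ((1 : G) : G ⧸ H) = q) (σ : G) :
    ∏ᶠ q, ϕ (halfTransferFactor (mem_iff_smul_quotient_one_eq (H := H)) hw σ q) = MonoidHom.transfer ϕ σ := by
  classical
  have hs : ∀ q : G ⧸ H, (w q : G ⧸ H) = q := fun q => by
    have := hw q
    rwa [MulAction.Quotient.smul_mk, smul_eq_mul, mul_one] at this
  let T : H.LeftTransversal := ⟨Set.range w, Subgroup.isComplement_range_left hs⟩
  rw [MonoidHom.transfer_def ϕ T σ]
  dsimp only [Subgroup.leftTransversals.diff]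
  letI : Fintype (G ⧸ H) := H.fintypeQuotientOfFiniteIndex
  rw [finprod_eq_prod_of_fintype]
  -- reindex the left-hand side by `q ↦ σ⁻¹ • q`
  rw [← Equiv.prod_comp (MulAction.toPerm σ⁻¹)
    (fun q => ϕ (halfTransferFactor (mem_iff_smul_quotient_one_eq (H := H)) hw σ q))]
  refine Finset.prod_congr rfl fun q _ => congrArg ϕ (Subtype.ext ?_)
  have h1 : ((T.2.leftQuotientEquiv q : G)) = w q := Subgroup.IsComplement.leftQuotientEquiv_apply hs q
  have h2 : (((σ • T).2.leftQuotientEquiv q : G)) = σ * w (σ⁻¹ • q) := by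
    rw [Subgroup.smul_apply_eq_smul_apply_inv_smul, smul_eq_mul, Subgroup.IsComplement.leftQuotientEquiv_apply hs]
  simp only [MulAction.toPerm_apply, coe_halfTransferFactor, smul_inv_smul]
  rw [h1, h2, mul_assoc]

/-- **`F_Φ(σ) · F_{Φᶜ}(σ) = Ver(σ)`** for `X = G ⧸ H` (any section `w`, any `Φ`).
[cite: Milne2007FundamentalCM, §4.2 Prop. 4.6 (proof: «F_Φ(σ)·F_{ιΦ}(σ) = Ver_{E/ℚ}(σ)»)] -/
theorem halfTransferWith_mul_halfTransferWith_compl_eq_transfer [H.FiniteIndex] {w : G ⧸ H → G}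
    (hw : ∀ q : G ⧸ H, w q • ((1 : G) : G ⧸ H) = q) (Φ : Set (G ⧸ H)) (σ : G) :
    halfTransferWith ϕ (mem_iff_smul_quotient_one_eq (H := H)) hw Φ σ *
        halfTransferWith ϕ (mem_iff_smul_quotient_one_eq (H := H)) hw Φᶜ σ = MonoidHom.transfer ϕ σ := by
  haveI : Finite (G ⧸ H) := Subgroup.finite_quotient_of_finiteIndex
  rw [halfTransferWith_mul_halfTransferWith_compl, finprod_halfTransferFactor_eq_transfer]

end Transfer

section Conj

variable {H : Subgroup G} {x₀ : X} (ϕ : H →* A) {ι : G} {Φ : Set X}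

/-- `ι` normalises `H`: `ι h ι⁻¹` fixes `x₀` when `h` does and `ι` is central on `X`.
[cite: Milne2007FundamentalCM, §4.2 Prop. 4.8 (b) («if τE = E»)] -/
theorem conj_mem_of_mem (hH : ∀ g : G, g ∈ H ↔ g • x₀ = x₀) (hΦ : IsCMTypeWith ι Φ) {h : G} (hh : h ∈ H) :
    ι * h * ι⁻¹ ∈ H := by
  rw [hH] at hh ⊢
  rw [mul_smul, mul_smul, hΦ.smul_inv_smul_comm h x₀, hh, smul_inv_smul]

/-- The factor of `F_{ιΦ}` at `ιx` computed with the section `ι w ι⁻¹` is `ι · (factor of F_Φ at x) · ι⁻¹` (`ι² = 1`).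
[cite: Milne2007FundamentalCM, §4.2 Prop. 4.6 (proof)] -/
theorem coe_halfTransferFactor_conj_smul (hH : ∀ g : G, g ∈ H ↔ g • x₀ = x₀) (hΦ : IsCMTypeWith ι Φ)
    (hι : ι * ι = 1) {w : X → G} (hw : IsSymmSection ι x₀ w) (σ : G) (x : X) :
    (halfTransferFactor hH (hw.conj hΦ).smul_base σ (ι • x) : G) =
      ι * (halfTransferFactor hH hw.smul_base σ x : G) * ι⁻¹ := by
  simp only [coe_halfTransferFactor]
  -- `w(σιx) = w(ισx) = ι w(σx)`, `w(ιx) = ι w(x)`, and `ι ι = 1`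
  rw [hΦ.comm σ x, hw.apply_smul, hw.apply_smul, ← mul_assoc ι ι (w (σ • x)), hι, one_mul,
    ← mul_assoc ι ι (w x), hι, one_mul]
  group

/-- **`F_{ιΦ}^{ϕ}(σ) = F_Φ^{ϕ'}(σ)` whenever `ϕ'(h) = ϕ(ι h ι⁻¹)`** — computing `F_{ιΦ}` with the symmetric section
`ι w ι⁻¹` conjugates every factor of `F_Φ` by `ι`; with `ϕ = [·]_{E^ab}` this is «`ι art_E(f) ι⁻¹ = F_{ιΦ}(σ)`» /
Prop. 4.8 (b) at `τ = ι` (`ι² = 1`, `X` finite, `Φ` a CM type).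
[cite: Milne2007FundamentalCM, §4.2 Prop. 4.6 (proof), Prop. 4.8 (b)] -/
theorem halfTransferWith_smul_eq [Finite X] (hH : ∀ g : G, g ∈ H ↔ g • x₀ = x₀) (hΦ : IsCMTypeWith ι Φ)
    (hι : ι * ι = 1) {w : X → G} (hw : IsSymmSection ι x₀ w) (ϕ' : H →* A)
    (hϕ' : ∀ (h : H) (hmem : ι * (h : G) * ι⁻¹ ∈ H), ϕ ⟨ι * h * ι⁻¹, hmem⟩ = ϕ' h) (σ : G) :
    halfTransferWith ϕ hH hw.smul_base (ι • Φ) σ = halfTransferWith ϕ' hH hw.smul_base Φ σ := by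
  -- compute `F_{ιΦ}` with the symmetric section `ι w ι⁻¹` (Lemma 4.4)
  rw [halfTransferWith_eq_of_isSymmSection ϕ hH (hΦ.smul_set' ι) hw (hw.conj hΦ) σ, halfTransferWith_def,
    halfTransferWith_def, ← Set.image_smul, finprod_mem_image (MulAction.injective ι).injOn]
  refine finprod_mem_congr rfl fun x _ => ?_
  rw [← hϕ' _ (conj_mem_of_mem hH hΦ (halfTransferFactor hH hw.smul_base σ x).2)]
  exact congrArg ϕ (Subtype.ext (coe_halfTransferFactor_conj_smul hH hΦ hι hw σ x))

/-- The same with the complement: **`F_{Φᶜ}^{ϕ}(σ) = F_Φ^{ϕ'}(σ)`** (`Φᶜ = ιΦ`).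
[cite: Milne2007FundamentalCM, §4.2 Prop. 4.6 (proof)] -/
theorem halfTransferWith_compl_eq [Finite X] (hH : ∀ g : G, g ∈ H ↔ g • x₀ = x₀) (hΦ : IsCMTypeWith ι Φ)
    (hι : ι * ι = 1) {w : X → G} (hw : IsSymmSection ι x₀ w) (ϕ' : H →* A)
    (hϕ' : ∀ (h : H) (hmem : ι * (h : G) * ι⁻¹ ∈ H), ϕ ⟨ι * h * ι⁻¹, hmem⟩ = ϕ' h) (σ : G) :
    halfTransferWith ϕ hH hw.smul_base Φᶜ σ = halfTransferWith ϕ' hH hw.smul_base Φ σ := by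
  rw [hΦ.compl_eq_smul_set]; exact halfTransferWith_smul_eq ϕ hH hΦ hι hw ϕ' hϕ' σ

end Conj

/-! ### §5. The half transfer `F_Φ` (section-free) -/

section HalfTransfer

variable {H : Subgroup G} (ϕ : H →* A) (x₀ : X) (hH : ∀ g : G, g ∈ H ↔ g • x₀ = x₀) (ι : G)

open Classical in
/-- **Tate's half transfer `F_Φ : G → A`, `σ ↦ ∏_{x∈Φ} ϕ(w(σx)⁻¹ σ w(x))`** for a symmetric system of
representatives `w` (any one — Lemma 4.4 —; the junk value `1` if none exists).  In print `G = Aut(ℂ)` (or `Γ_ℚ`),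
`X = Hom(E, ℂ)`, `H = Aut(ℂ/E)`, `ϕ : H → Gal(E^ab/E)`, `ι` = complex conjugation, and `F_Φ(σ) = ∏_{φ∈Φ} w_{σφ}⁻¹ σ w_φ
mod Aut(ℂ/E^ab)`. [cite: Milne2007FundamentalCM, §4.2 (definition of F_Φ), Lemma 4.4]
[cite: Blake2016PlecticTaniyama, §1 («Tate wrote down half-transfer map F_Φ : Γ_ℚ → Γ_K^ab»)] -/
def halfTransfer (Φ : Set X) (σ : G) : A :=
  if h : ∃ w : X → G, IsSymmSection ι x₀ w then halfTransferWith ϕ hH h.choose_spec.smul_base Φ σ else 1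

variable {x₀ ι} {Φ : Set X}

/-- **`F_Φ` is computed by ANY symmetric system of representatives** (Lemma 4.4).
[cite: Milne2007FundamentalCM, §4.2 Lemma 4.4] -/
theorem halfTransfer_eq_halfTransferWith [Finite X] (hΦ : IsCMTypeWith ι Φ) {w : X → G} (hw : IsSymmSection ι x₀ w)
    (σ : G) : halfTransfer ϕ x₀ hH ι Φ σ = halfTransferWith ϕ hH hw.smul_base Φ σ := by
  have hex : ∃ w : X → G, IsSymmSection ι x₀ w := ⟨w, hw⟩
  rw [halfTransfer, dif_pos hex]
  exact halfTransferWith_eq_of_isSymmSection ϕ hH hΦ hex.choose_spec hw σ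

variable [Finite X] [MulAction.IsPretransitive G X] (hΦ : IsCMTypeWith ι Φ) (hι : ι * ι = 1)
include hΦ hι

/-- `F_Φ(1) = 1`. [cite: Milne2007FundamentalCM, §4.2 Prop. 4.8] -/
theorem halfTransfer_one : halfTransfer ϕ x₀ hH ι Φ 1 = 1 := by
  obtain ⟨w, hw⟩ := exists_isSymmSection hι x₀ hΦ
  rw [halfTransfer_eq_halfTransferWith ϕ hH hΦ hw, halfTransferWith_one]

/-- **`F_Φ(ι) = 1`** («(c) `f_Φ(ι) = 1`» at the level of `F`). [cite: Milne2007FundamentalCM, §4.2 Prop. 4.8 (c)] -/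
theorem halfTransfer_self : halfTransfer ϕ x₀ hH ι Φ ι = 1 := by
  obtain ⟨w, hw⟩ := exists_isSymmSection hι x₀ hΦ
  rw [halfTransfer_eq_halfTransferWith ϕ hH hΦ hw]
  exact halfTransferWith_eq_one_of_isSymmSection ϕ hH hw Φ

/-- **PROP. 4.8 (a) at the level of `F`: `F_Φ(στ) = F_{τΦ}(σ) · F_Φ(τ)`.** [cite: Milne2007FundamentalCM, §4.2 Prop. 4.8 (a)] -/
theorem halfTransfer_mul (σ τ : G) :
    halfTransfer ϕ x₀ hH ι Φ (σ * τ) = halfTransfer ϕ x₀ hH ι (τ • Φ) σ * halfTransfer ϕ x₀ hH ι Φ τ := by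
  obtain ⟨w, hw⟩ := exists_isSymmSection hι x₀ hΦ
  rw [halfTransfer_eq_halfTransferWith ϕ hH hΦ hw, halfTransfer_eq_halfTransferWith ϕ hH hΦ hw,
    halfTransfer_eq_halfTransferWith ϕ hH (hΦ.smul_set' τ) hw, halfTransferWith_mul ϕ hH _ (Set.toFinite _)]

/-- `F_Φ(στ) = F_Φ(σ)·F_Φ(τ)` when `τΦ = Φ`: **`F_Φ` is a homomorphism on the stabiliser of `Φ`** (in print
`Aut(ℂ/E*)`, `E*` the reflex field). [cite: Milne2007FundamentalCM, §4.2 Prop. 4.8 (a), Prop. 4.9] -/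
theorem halfTransfer_mul_of_smul_eq (σ : G) {τ : G} (hτ : τ • Φ = Φ) :
    halfTransfer ϕ x₀ hH ι Φ (σ * τ) = halfTransfer ϕ x₀ hH ι Φ σ * halfTransfer ϕ x₀ hH ι Φ τ := by
  rw [halfTransfer_mul ϕ hH hΦ hι, hτ]

omit [MulAction.IsPretransitive G X] hι in
/-- **`F_Φ(σ) · F_{Φᶜ}(σ)` is the full transfer product `∏_{x∈X} ϕ(w(σx)⁻¹ σ w(x))`** (any symmetric section `w`).
[cite: Milne2007FundamentalCM, §4.2 Prop. 4.6 (proof)] -/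
theorem halfTransfer_mul_halfTransfer_compl {w : X → G} (hw : IsSymmSection ι x₀ w) (σ : G) :
    halfTransfer ϕ x₀ hH ι Φ σ * halfTransfer ϕ x₀ hH ι Φᶜ σ = ∏ᶠ x, ϕ (halfTransferFactor hH hw.smul_base σ x) := by
  rw [halfTransfer_eq_halfTransferWith ϕ hH hΦ hw, halfTransfer_eq_halfTransferWith ϕ hH hΦ.compl' hw,
    halfTransferWith_mul_halfTransferWith_compl]

/-- **`F_{ιΦ}^{ϕ}(σ) = F_Φ^{ϕ'}(σ)` for `ϕ' = ϕ ∘ Inn(ι)`** («`ι art_E(f) ι⁻¹ = F_{ιΦ}(σ)`»; Prop. 4.8 (b) at `τ = ι`).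
[cite: Milne2007FundamentalCM, §4.2 Prop. 4.6 (proof), Prop. 4.8 (b)] -/
theorem halfTransfer_smul_eq (ϕ' : H →* A)
    (hϕ' : ∀ (h : H) (hmem : ι * (h : G) * ι⁻¹ ∈ H), ϕ ⟨ι * h * ι⁻¹, hmem⟩ = ϕ' h) (σ : G) :
    halfTransfer ϕ x₀ hH ι (ι • Φ) σ = halfTransfer ϕ' x₀ hH ι Φ σ := by
  obtain ⟨w, hw⟩ := exists_isSymmSection hι x₀ hΦ
  rw [halfTransfer_eq_halfTransferWith ϕ hH (hΦ.smul_set' ι) hw, halfTransfer_eq_halfTransferWith ϕ' hH hΦ hw,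
    halfTransferWith_smul_eq ϕ hH hΦ hι hw ϕ' hϕ']

/-- **`F_{Φᶜ}^{ϕ}(σ) = F_Φ^{ϕ'}(σ)` for `ϕ' = ϕ ∘ Inn(ι)`** (`Φᶜ = ιΦ`). [cite: Milne2007FundamentalCM, §4.2 Prop. 4.6 (proof)] -/
theorem halfTransfer_compl_eq (ϕ' : H →* A)
    (hϕ' : ∀ (h : H) (hmem : ι * (h : G) * ι⁻¹ ∈ H), ϕ ⟨ι * h * ι⁻¹, hmem⟩ = ϕ' h) (σ : G) :
    halfTransfer ϕ x₀ hH ι Φᶜ σ = halfTransfer ϕ' x₀ hH ι Φ σ := by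
  rw [hΦ.compl_eq_smul_set]; exact halfTransfer_smul_eq ϕ hH hΦ hι ϕ' hϕ' σ

/-- **«`F_Φ(σ) · ι F_Φ(σ) ι⁻¹ = Ver(σ)`» in product form**: `F_Φ^{ϕ}(σ) · F_Φ^{ϕ∘Inn(ι)}(σ) = ∏_{x∈X} ϕ(w(σx)⁻¹σw(x))`.
[cite: Milne2007FundamentalCM, §4.2 Prop. 4.6 (proof)] -/
theorem halfTransfer_mul_halfTransfer_conj (ϕ' : H →* A)
    (hϕ' : ∀ (h : H) (hmem : ι * (h : G) * ι⁻¹ ∈ H), ϕ ⟨ι * h * ι⁻¹, hmem⟩ = ϕ' h) {w : X → G}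
    (hw : IsSymmSection ι x₀ w) (σ : G) :
    halfTransfer ϕ x₀ hH ι Φ σ * halfTransfer ϕ' x₀ hH ι Φ σ = ∏ᶠ x, ϕ (halfTransferFactor hH hw.smul_base σ x) := by
  rw [← halfTransfer_compl_eq ϕ hH hΦ hι ϕ' hϕ', halfTransfer_mul_halfTransfer_compl ϕ hH hΦ hw]

/-- Transport along `ψ : A →* B`: `ψ(F_Φ^{ϕ}(σ)) = F_Φ^{ψ∘ϕ}(σ)`. [cite: Milne2007FundamentalCM, §4.2 Lemma 4.5] -/
theorem map_halfTransfer {B : Type*} [CommGroup B] (ψ : A →* B) (σ : G) :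
    ψ (halfTransfer ϕ x₀ hH ι Φ σ) = halfTransfer (ψ.comp ϕ) x₀ hH ι Φ σ := by
  obtain ⟨w, hw⟩ := exists_isSymmSection hι x₀ hΦ
  rw [halfTransfer_eq_halfTransferWith ϕ hH hΦ hw, halfTransfer_eq_halfTransferWith (ψ.comp ϕ) hH hΦ hw,
    map_halfTransferWith ϕ hH _ ψ (Set.toFinite _)]

end HalfTransfer

section QuotientTransfer

variable {H : Subgroup G} [H.FiniteIndex] (ϕ : H →* A) {ι : G} {Φ : Set (G ⧸ H)}

/-- **`F_Φ(σ) · F_{Φᶜ}(σ) = Ver(σ)`** — for `X = G ⧸ H` the two half transfers multiply to Mathlib's transfer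
`MonoidHom.transfer ϕ` («`F_Φ(σ)·F_{ιΦ}(σ) = Ver_{E/ℚ}(σ)`»). [cite: Milne2007FundamentalCM, §4.2 Prop. 4.6 (proof)]
[cite: NeukirchANT1999, Ch. IV §5 p. 271 (definition of Ver)] -/
theorem halfTransfer_mul_halfTransfer_compl_eq_transfer (hΦ : IsCMTypeWith ι Φ) (hι : ι * ι = 1) (σ : G) :
    halfTransfer ϕ ((1 : G) : G ⧸ H) (mem_iff_smul_quotient_one_eq (H := H)) ι Φ σ *
      halfTransfer ϕ ((1 : G) : G ⧸ H) (mem_iff_smul_quotient_one_eq (H := H)) ι Φᶜ σ = MonoidHom.transfer ϕ σ := by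
  haveI : Finite (G ⧸ H) := Subgroup.finite_quotient_of_finiteIndex
  obtain ⟨w, hw⟩ := exists_isSymmSection hι ((1 : G) : G ⧸ H) hΦ
  rw [halfTransfer_mul_halfTransfer_compl ϕ _ hΦ hw, finprod_halfTransferFactor_eq_transfer]

/-- **«`F_Φ(σ) · ι F_Φ(σ) ι⁻¹ = Ver(σ)`»**: `F_Φ^{ϕ}(σ) · F_Φ^{ϕ ∘ Inn(ι)}(σ) = MonoidHom.transfer ϕ σ` for `X = G ⧸ H`.
[cite: Milne2007FundamentalCM, §4.2 Prop. 4.6 (proof)] -/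
theorem halfTransfer_mul_halfTransfer_conj_eq_transfer (hΦ : IsCMTypeWith ι Φ) (hι : ι * ι = 1) (ϕ' : H →* A)
    (hϕ' : ∀ (h : H) (hmem : ι * (h : G) * ι⁻¹ ∈ H), ϕ ⟨ι * h * ι⁻¹, hmem⟩ = ϕ' h) (σ : G) :
    halfTransfer ϕ ((1 : G) : G ⧸ H) (mem_iff_smul_quotient_one_eq (H := H)) ι Φ σ *
      halfTransfer ϕ' ((1 : G) : G ⧸ H) (mem_iff_smul_quotient_one_eq (H := H)) ι Φ σ = MonoidHom.transfer ϕ σ := by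
  haveI : Finite (G ⧸ H) := Subgroup.finite_quotient_of_finiteIndex
  rw [← halfTransfer_compl_eq ϕ _ hΦ hι ϕ' hϕ', halfTransfer_mul_halfTransfer_compl_eq_transfer ϕ hΦ hι]

end QuotientTransfer

end Literature.NumberTheory.ComplexMultiplication

end
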